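import Summits.BirchSwinnertonDyer.Rank1Residual.X11b.ChaPairs1
import Summits.BirchSwinnertonDyer.Rank1Residual.Supersingular.IntModelMinimalityKrausTwoMore
import Summits.BirchSwinnertonDyer.Rank1Residual.X11b.CertificateCheckBridge
import Literature.NumberTheory.EllipticCurves.Rank1Residual.Typed.X10bHeegnerIndexCertificate
import Literature.NumberTheory.EllipticCurves.ComplexMultiplicationNotSemistable
import Summits.BirchSwinnertonDyer.Rank1Residual.X11a.ChaRecords1
import HarnessLib

/-!
# Class X11a at `p = 3`, NON-surjective image (`3Ns`/`3Nn`): per-pair HEEGNER-INDEX (Cha) sockets AND the p3 road's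
# UNIT-VALUE door — the `p = 3` stub's domain (`stub_upperNonSurjThree`), file 2/3 — `4704e1`, `9408j1` (cell `bsd-print-x11a`, PLAN v2 §2; `--supports stmt-BirchSwinnertonDyer-20406`)

HONEST FRAMING (cells `b2b-bsdres` / `bsd-print-x11a`, verbatim): the goal is to DELETE the
COMBINATION-SHAPED residual classes of the Birch–Swinnerton-Dyer formula for ALL analytic-rank
`≤ 1` elliptic curves over `ℚ` — "full BSD formula for every rank `≤ 1` curve in class `C`"
assembled STRICTLY from published theorems — so that the rank-`≤ 1` remainder becomes exactly the
CONSTRUCTION-SHAPED classes, which are TYPED (missing-input `Prop`s), NOT attempted. This is not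
"finishing BSD". PER PAIR: theorems only, no definition, no named fact; nothing is booked by this
file and no class label changes (referee / planner). The CLASS-level upper half on the non-surjective
leaf (crux `PrintX11a.X11aNonSurjEulerHalf`, item 20406) stays OPEN.

## What

Companion of p4's `X11a/ChaRecords2.lean` / `ChaRecords3.lean` (the `N ≥ 10⁵` half; grammar followed verbatim):
the same two doors at `p = 3`: the NON-SPLIT non-surjective X11a pairs at `3` of ty3's census (`N < 2·10⁴`, images `3Ns`/`3Nn`)
with `3 ∤ ∏c_ℓ · #Ш_an · L(E,1)/Ω_E` (5 of the 12 pairs; no per-pair certificate at `p = 3` existed in the tree, REF g2 15:08Z). Per pair THREE theorems: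
`bsdp3_c<label>` (`BSDp W 3`) and `mub3_c<label>` (`MissingUpperBoundAt W 3`) through the Cha 2005 Thm 21 /
Miller 2011 Thm 5.2 HEEGNER-INDEX door (`X11b.bsdp_of_ainvs_of_chaCertificate`,
`Typed.missingUpperBoundAt_of_cha_of_index_le`; the Heegner datum is DISPLAYED — cell ty3's two-engine kit job
plugs in), and **`mub3_c<label>_of_katoFacts`** through the p3 road (seat p3 g1, `Theorems/PrintX11aNonSurjEulerHalfOfMu.lean`
p539522): NON-split (KERNEL: node-tangent quadratic root-free mod `3`) + `L(E,1)/Ω_E` a `3`-adic unit (DISPLAYED: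
`ht`, `hunit` — Cremona's `L/Ω`; `r_an = 0` and `¬Surj` displayed) ⟹ the constant term of the Néron-normalised
Mazur–Tate–Teitelbaum function is a unit (`X11b.MuAnUnit.…`) ⟹ analytic `μ = 0` ⟹ Kato's integral divisibility
(corner-p1 g6 μ-transfer without big image + bsd-2adic ⊗ℚ divisibility, `X11b.multDivisibilityAt_of_katoFacts_of_muAn`)
⟹ `ord₃ #Ш ≤ ord₃ #Ш_an` (engine `X11b.missingUpperBoundAt_of_multDivisibilityAt_of_analyticRank_eq_zero`) — modulo
THIRTEEN named facts (three construction facts of bsd-2adic / bsd-stepL, flags `Kato-17.11-at-{nonsplit,split}-mult`,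
`Kato-p280-image-at-mult`) and Greenberg–Stevens at the pair; NO further computation. The shared tool
`mub_of_unitValue_nonsplit` (file 1) is the class-free form of p3's `x11a_missingUpperBoundAt_of_not_surj_of_nonsplit_of_unit_value`
(route-file-free restatement, so that record files do not import `Theses/PrintX11a.lean`). KERNEL per pair: `Δ ≠ 0`,
global minimality (Kraus, complete factorisation), `3 ∣ Δ ∧ 3 ∤ c₄`, `E[3]` irreducible by a Frobenius witness
(`card_c<label>_ℓ`), non-split at `3`, `¬CM`. Curve data from ty3's census (`x11a_N1e4.tsv`: a-invariants,
image `3Ns`/`3Nn`, non-split, `∏c_ℓ`, `#Ш_an = 1`, `L/Ω`). The tool `mub_of_unitValue_nonsplit` is imported from `ChaRecords1.lean`.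

References: [Miller2011LMS] Thm. 5.2, Def. 1.1; [Mazur1978] Prop. 6.3; [SilvermanAEC2009] VII.1 Rem. 1.1, VII.5.1;
[Kraus1989]; [Cremona2006]; [MazurTateTeitelbaum1986] §I.10; [Wuthrich2014] Cor. 18; [Kato2004Asterisque] §17.13;
`X11a/ChaRecords2.lean` (p4, template); `Theorems/PrintX11aNonSurjEulerHalfOfMu.lean` (p3); HOME/PLAN.md v2 §2,
HOME/P3-EXCEPTIONAL-ZERO-ROAD.md §5 (the 26 + 5 unit-value pairs).
-/

set_option autoImplicit false

noncomputable section

open scoped Classical MatrixGroups ModularForm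

open WeierstrassCurve Literature.NumberTheory.EllipticCurves
  Literature.NumberTheory.EllipticCurves.ModularForms
  Literature.NumberTheory.EllipticCurves.Rank1Residual
  Literature.NumberTheory.EllipticCurves.Rank1Residual.Typed
  Literature.NumberTheory.EllipticCurves.Rank1Residual.X11RankOneCertificates
  Literature.NumberTheory.EllipticCurves.Cha2005
  Literature.NumberTheory.EllipticCurves.Wuthrich2014
  Literature.NumberTheory.EllipticCurves.SteinWuthrich2013
  Literature.NumberTheory.EllipticCurves.Greenberg1999
  Literature.NumberTheory.EllipticCurves.Kato2004
  NumberField IsDedekindDomain Rat.HeightOneSpectrum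
  Summit.BirchSwinnertonDyer.BirchSwinnertonDyer.Rank1Residual.IntModel
  Summit.BirchSwinnertonDyer.BirchSwinnertonDyer.Rank1Residual.X11RankOne
  Summit.BirchSwinnertonDyer.Rank1Residual.Supersingular
  Summit.BirchSwinnertonDyer.Rank1Residual.X11b

namespace Summit.BirchSwinnertonDyer.Rank1Residual.X11a.ChaRecords

/-! ### `4704e1 @ 3` (`N = 4704`, image `3Nn`, NON-split multiplicative at `3`, `∏ c_ℓ = 4`, `#Ш_an = 4`, `L(E,1)/Ω_E = 4/1`) -/

/-- `4704e1 = [0, -1, 0, -12462, -531180]` is globally minimal: `|Δ| = 2⁶ · 3³ · 7⁹` (kernel) + Kraus.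
[cite: SilvermanAEC2009, VII.1 Remark 1.1] [cite: Kraus1989, Prop. 1 and Prop. 2] -/
theorem isGloballyMinimal_c4704e1 : (⟨0, -1, 0, -12462, -531180⟩ : WeierstrassCurve ℚ).IsGloballyMinimal :=
  isGloballyMinimal_of_krausCriterion₃_factored 0 (-1) 0 (-12462) (-531180)
    [(2, 6), (3, 3), (7, 9)] (by decide +kernel)
    (by intro qe hqe; simp only [List.mem_cons, List.not_mem_nil, or_false] at hqe
        rcases hqe with rfl | rfl | rfl <;> norm_num)
    (by intro qe hqe; simp only [List.mem_cons, List.not_mem_nil, or_false] at hqe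
        rcases hqe with rfl | rfl | rfl
        · exact Or.inl (by decide +kernel)
        · exact Or.inl (by decide +kernel)
        · exact Or.inl (by decide +kernel))

/-- `#Ẽ(𝔽_11) = 14` for `4704e1` (`a_11 = -2`; `X² − a_11X + 11` root-free mod `3`: the Frobenius
irreducibility witness, kernel count `countPoints`). [folklore] -/
theorem card_c4704e1_11 :
    Nat.card (((⟨0, -1, 0, -12462, -531180⟩ : WeierstrassCurve ℤ).map (Int.castRingHom (ZMod 11))).toAffine.Point) = 14 := by
  have h := X11b.natCard_point_eq_countPoints 0 (-1) 0 (-12462) (-531180) 11 (by norm_num) (by decide +kernel)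
  have h' : countPoints [0, -1, 0, -12462, -531180] 11 = 14 := by decide +kernel
  exact_mod_cast h.trans h'

/-- The node-tangent quadratic of `4704e1` mod `3` is root-free: NON-split multiplicative reduction at `3`
(kernel decision; Silverman *AEC* VII.5.1(b)). [cite: SilvermanAEC2009, VII.5 Prop. 5.1(b)] -/
theorem nodal_c4704e1 :
    letI E₀ : WeierstrassCurve ℤ := ⟨0, -1, 0, -12462, -531180⟩
    ∀ t : ZMod 3, (E₀.c₄ : ZMod 3) * t ^ 2 + (E₀.a₁ * E₀.c₄ : ZMod 3) * t
      - (54 * E₀.b₆ - 3 * E₀.b₂ * E₀.b₄ + E₀.a₂ * E₀.c₄ : ZMod 3) ≠ 0 := by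
  decide +kernel

/-- **`BSD(E,3)` for `4704e1`** (`N = 4704`; image `3Nn` — the NON-surjective leaf of X11a, crux
`X11aNonSurjEulerHalf`'s domain; non-split multiplicative at `3`; `#Ш_an = 4`, `∏ c_ℓ = 4`, `3`-adic units)
from Cha 2005 Thm 21 / Miller 2011 Thm 5.2 (`hCha`) + GZK (`hGZK`) and a Heegner-index certificate
DISPLAYED as binders (`K` imaginary quadratic, Heegner for the level `N`, `3 ∤ d_K`, `9 ∤ N`, Heegner
point `P` of infinite order with `3 ∤ [E(K) : ℤP]` — cell ty3's two-engine kit job, HOME/PLAN.md v2 §2),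
`r_an ≤ 1`, `#Ш_an` a `3`-unit. Kernel: `Δ ≠ 0`, minimality, `3 ∣ Δ ∧ 3 ∤ c₄`, `E[3]` irreducible by
`card_c4704e1_11`. Grammar = p4's `X11a.ChaRecords.bsdp5_c<label>` (door `X11b.bsdp_of_ainvs_of_chaCertificate`).
PER PAIR; nothing booked. [cite: Miller2011LMS, Thm. 5.2 and Def. 1.1] [cite: Cremona2006, Table 1 (Cremona label 4704e1)] -/
theorem bsdp3_c4704e1 (hCha : thm52_padicValNat_shaOrder_le)
    (hGZK : rank_eq_analyticRank_of_analyticRank_le_one)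
    (W : WeierstrassCurve ℚ) (hW : W = ⟨0, -1, 0, -12462, -531180⟩)
    {N : ℕ} [NeZero N] {K : Type} [Field K] [NumberField K] (hK : IsImaginaryQuadratic K)
    (hH : SatisfiesHeegnerHypothesis N K) {P : (W.baseChange K).toAffine.Point}
    (hP : IsHeegnerPoint N W K P) (hnt : ¬ IsOfFinAddOrder P)
    (hpD : ¬ (3 : ℤ) ∣ NumberField.discr K) (hpN : ¬ 3 ^ 2 ∣ N)
    (hI : ¬ 3 ∣ (AddSubgroup.zmultiples P).index)
    (hr : W.analyticRank ≤ 1) {q : ℚ} (hq : shaAn W = (q : ℂ)) (hv : padicValRat 3 q = 0) :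
    BSDp W 3 := by
  haveI : W.IsElliptic := by rw [hW]; exact X11b.isElliptic_of_discOf_ne_zero 0 (-1) 0 (-12462) (-531180) (by decide +kernel)
  haveI : W.IsGloballyMinimal := by rw [hW]; exact isGloballyMinimal_c4704e1
  haveI : Fact (Nat.Prime 3) := ⟨by norm_num⟩
  haveI : Fact (Nat.Prime 11) := ⟨by norm_num⟩
  have hI' : integralModelInt W = ⟨0, -1, 0, -12462, -531180⟩ := by
    subst hW; exact integralModelInt_eq_of_map_eq _ (map_mk_int 0 (-1) 0 (-12462) (-531180))
  exact X11b.bsdp_of_ainvs_of_chaCertificate hCha hGZK 0 (-1) 0 (-12462) (-531180) hI'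
    3 11 14 (by decide) (by decide +kernel) (by decide +kernel) (by decide) (by decide +kernel) card_c4704e1_11
    (by decide +kernel) hK hH hP hnt (mod_cast hpD) hpN hI hr hq hv

/-- **`4704e1 @ 3`: the UPPER half `ord_3 #Ш ≤ ord_3 #Ш_an`** (`Typed.MissingUpperBoundAt W 3`, the currency of
crux `X11aNonSurjEulerHalf`) from Cha's Heegner-index bound (`hCha`; door `Typed.missingUpperBoundAt_of_cha_of_index_le`,
`k := 0`), the index certificate displayed as `hI : ord_3 [E(K) : ℤP] ≤ 0`; `¬CM` and `E[3]` irreducible in the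
kernel. PER PAIR; nothing booked. [cite: Miller2011LMS, Thm. 5.2] [cite: Mazur1978, §6 Prop. 6.3 (1) (p. 153)]
[cite: Cremona2006, Table 1 (Cremona label 4704e1)] -/
theorem mub3_c4704e1 (hCha : thm52_padicValNat_shaOrder_le)
    (W : WeierstrassCurve ℚ) (hW : W = ⟨0, -1, 0, -12462, -531180⟩)
    {N : ℕ} [NeZero N] {K : Type} [Field K] [NumberField K] (hK : IsImaginaryQuadratic K)
    (hH : SatisfiesHeegnerHypothesis N K) {P : (W.baseChange K).toAffine.Point}
    (hP : IsHeegnerPoint N W K P) (hnt : ¬ IsOfFinAddOrder P)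
    (hpD : ¬ (3 : ℤ) ∣ NumberField.discr K) (hpN : ¬ 3 ^ 2 ∣ N)
    (hI : padicValNat 3 (AddSubgroup.zmultiples P).index ≤ 0)
    (hr : W.analyticRank ≤ 1) {q : ℚ} (hq : shaAn W = (q : ℂ)) (hv : (0 : ℤ) ≤ padicValRat 3 q) :
    MissingUpperBoundAt W 3 := by
  haveI : W.IsElliptic := by rw [hW]; exact X11b.isElliptic_of_discOf_ne_zero 0 (-1) 0 (-12462) (-531180) (by decide +kernel)
  haveI : W.IsGloballyMinimal := by rw [hW]; exact isGloballyMinimal_c4704e1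
  haveI : Fact (Nat.Prime 3) := ⟨by norm_num⟩
  haveI : Fact (Nat.Prime 11) := ⟨by norm_num⟩
  have hI' : integralModelInt W = ⟨0, -1, 0, -12462, -531180⟩ := by
    subst hW; exact integralModelInt_eq_of_map_eq _ (map_mk_int 0 (-1) 0 (-12462) (-531180))
  have hmult : Mult W 3 :=
    hasMultiplicativeReductionAtPrime_of_intModel hI' 3 (by decide +kernel) (by decide +kernel)
  have hcm : ¬ W.HasCM := fun h ↦ not_hasMultiplicativeReductionAtPrime_of_hasCM W h 3 hmult
  have hirr : Irr W 3 :=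
    hasIrreducibleModPGaloisRep_of_intModel_of_noroot (hp := ⟨by norm_num⟩) (hℓ := ⟨by norm_num⟩)
      hI' 3 11 (by norm_num) (by decide +kernel) card_c4704e1_11 (by decide)
  exact missingUpperBoundAt_of_cha_of_index_le W 3 hCha hcm hr hK hH hP hnt (by norm_num) hpD hpN hirr
    (k := 0) hI hq (by simpa using hv)

/-- **`4704e1 @ 3`: the UPPER half from the p3 road's UNIT-VALUE door** (no Heegner datum): the pair is
NON-split multiplicative at `3` (kernel: the node-tangent quadratic is root-free mod `3`) and
`L(E,1)/Ω_E = 4/1` is a `3`-adic unit (DISPLAYED: Cremona's `L/Ω`, binder `ht`/`hunit`; `r_an = 0` and the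
image bit `¬Surj` displayed), so the constant term of the Néron-normalised Mazur–Tate–Teitelbaum function is a
unit ⟹ analytic `μ = 0` ⟹ (corner-p1 g6 transfer, F1-mult) `μ(X(E/ℚ_∞)) = 0` ⟹ Kato's integral divisibility
⟹ (rank-`0` engine) `ord_3 #Ш ≤ ord_3 #Ш_an` — modulo the THIRTEEN named facts of
`Theorems.x11aNonSurjEulerHalf_of_katoFacts_of_muAn` (three of them construction facts, flags
`Kato-17.11-at-{nonsplit,split}-mult`, `Kato-p280-image-at-mult`) and Greenberg–Stevens at the pair. Kernel:
minimality, `Mult`, `Irr` (`card_c4704e1_11`), non-split, `¬Ram` (from `Irr ∧ ¬Surj`). PER PAIR; nothing booked.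
[cite: MazurTateTeitelbaum1986, §I.10] [cite: Wuthrich2014, Cor. 18 (p. 398)] [cite: Kato2004Asterisque, §17.13 (pp. 279–280)]
[cite: Cremona2006, Table 1 (Cremona label 4704e1)] -/
theorem mub3_c4704e1_of_katoFacts
    (hJs : thm61_splitMultiplicative) (hJn : thm61_nonsplitMultiplicative)
    (hGZK : rank_eq_analyticRank_of_analyticRank_le_one) (hmod : hasEntireLFunction_rat)
    (hpar : nonempty_modularParametrizationData)
    (hne : Kato2004.nonempty_iwasawaH1Data) (h12 : Kato2004.thm12_4)
    (hns : Kato2004.exists_multDivisibilityInputs_nonsplit)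
    (hsp : Kato2004.exists_multDivisibilityInputs_split)
    (h15 : thm15_isTorsion_multiplicative_rat)
    (h18 : Wuthrich2014.corollary18_padicLFunction_mem_iwasawaAlgebra_multiplicative)
    (hfine : Kato2004.exists_multDivisibilityInputs_fine)
    (W : WeierstrassCurve ℚ) (hW : W = ⟨0, -1, 0, -12462, -531180⟩)
    (hGS : ∀ [W.IsElliptic] [W.IsGloballyMinimal] [Fact (Nat.Prime 3)], greenberg_stevens (W := W) (p := 3))
    (hr : W.analyticRank = 0) (hnsj : ∀ [Fact (Nat.Prime 3)], ¬ Surj W 3)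
    (t : ℚ) (ht : W.entireLFunction 1 / (W.realPeriodRat : ℂ) = (t : ℂ)) (hunit : padicValRat 3 t = 0) :
    MissingUpperBoundAt W 3 := by
  haveI : W.IsElliptic := by rw [hW]; exact X11b.isElliptic_of_discOf_ne_zero 0 (-1) 0 (-12462) (-531180) (by decide +kernel)
  haveI : W.IsGloballyMinimal := by rw [hW]; exact isGloballyMinimal_c4704e1
  haveI : Fact (Nat.Prime 3) := ⟨by norm_num⟩
  haveI : Fact (Nat.Prime 11) := ⟨by norm_num⟩
  have hI' : integralModelInt W = ⟨0, -1, 0, -12462, -531180⟩ := by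
    subst hW; exact integralModelInt_eq_of_map_eq _ (map_mk_int 0 (-1) 0 (-12462) (-531180))
  have hmult : Mult W 3 :=
    hasMultiplicativeReductionAtPrime_of_intModel hI' 3 (by decide +kernel) (by decide +kernel)
  have hirr : Irr W 3 :=
    hasIrreducibleModPGaloisRep_of_intModel_of_noroot (hp := ⟨by norm_num⟩) (hℓ := ⟨by norm_num⟩)
      hI' 3 11 (by norm_num) (by decide +kernel) card_c4704e1_11 (by decide)
  have hnsp : ¬ W.HasSplitMultiplicativeReductionAtPrime 3 :=
    not_hasSplitMultiplicativeReductionAtPrime_of_intModel_of_noroot hI' 3 (by decide +kernel)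
      (by decide +kernel) nodal_c4704e1
  exact mub_of_unitValue_nonsplit hJs hJn hGZK hmod hpar hne h12 hns hsp h15 h18 hfine W 3 hGS
    (by decide) hr hmult hirr hnsj hnsp t ht hunit

/-! ### `9408j1 @ 3` (`N = 9408`, image `3Nn`, NON-split multiplicative at `3`, `∏ c_ℓ = 4`, `#Ш_an = 1`, `L(E,1)/Ω_E = 1/1`) -/

/-- `9408j1 = [0, -1, 0, -72, 162]` is globally minimal: `|Δ| = 2⁶ · 3⁶ · 7³` (kernel) + Kraus.
[cite: SilvermanAEC2009, VII.1 Remark 1.1] [cite: Kraus1989, Prop. 1 and Prop. 2] -/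
theorem isGloballyMinimal_c9408j1 : (⟨0, -1, 0, -72, 162⟩ : WeierstrassCurve ℚ).IsGloballyMinimal :=
  isGloballyMinimal_of_krausCriterion₃_factored 0 (-1) 0 (-72) 162
    [(2, 6), (3, 6), (7, 3)] (by decide +kernel)
    (by intro qe hqe; simp only [List.mem_cons, List.not_mem_nil, or_false] at hqe
        rcases hqe with rfl | rfl | rfl <;> norm_num)
    (by intro qe hqe; simp only [List.mem_cons, List.not_mem_nil, or_false] at hqe
        rcases hqe with rfl | rfl | rfl
        · exact Or.inl (by decide +kernel)
        · exact Or.inl (by decide +kernel)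
        · exact Or.inl (by decide +kernel))

/-- `#Ẽ(𝔽_11) = 10` for `9408j1` (`a_11 = 2`; `X² − a_11X + 11` root-free mod `3`: the Frobenius
irreducibility witness, kernel count `countPoints`). [folklore] -/
theorem card_c9408j1_11 :
    Nat.card (((⟨0, -1, 0, -72, 162⟩ : WeierstrassCurve ℤ).map (Int.castRingHom (ZMod 11))).toAffine.Point) = 10 := by
  have h := X11b.natCard_point_eq_countPoints 0 (-1) 0 (-72) 162 11 (by norm_num) (by decide +kernel)
  have h' : countPoints [0, -1, 0, -72, 162] 11 = 10 := by decide +kernel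
  exact_mod_cast h.trans h'

/-- The node-tangent quadratic of `9408j1` mod `3` is root-free: NON-split multiplicative reduction at `3`
(kernel decision; Silverman *AEC* VII.5.1(b)). [cite: SilvermanAEC2009, VII.5 Prop. 5.1(b)] -/
theorem nodal_c9408j1 :
    letI E₀ : WeierstrassCurve ℤ := ⟨0, -1, 0, -72, 162⟩
    ∀ t : ZMod 3, (E₀.c₄ : ZMod 3) * t ^ 2 + (E₀.a₁ * E₀.c₄ : ZMod 3) * t
      - (54 * E₀.b₆ - 3 * E₀.b₂ * E₀.b₄ + E₀.a₂ * E₀.c₄ : ZMod 3) ≠ 0 := by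
  decide +kernel

/-- **`BSD(E,3)` for `9408j1`** (`N = 9408`; image `3Nn` — the NON-surjective leaf of X11a, crux
`X11aNonSurjEulerHalf`'s domain; non-split multiplicative at `3`; `#Ш_an = 1`, `∏ c_ℓ = 4`, `3`-adic units)
from Cha 2005 Thm 21 / Miller 2011 Thm 5.2 (`hCha`) + GZK (`hGZK`) and a Heegner-index certificate
DISPLAYED as binders (`K` imaginary quadratic, Heegner for the level `N`, `3 ∤ d_K`, `9 ∤ N`, Heegner
point `P` of infinite order with `3 ∤ [E(K) : ℤP]` — cell ty3's two-engine kit job, HOME/PLAN.md v2 §2),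
`r_an ≤ 1`, `#Ш_an` a `3`-unit. Kernel: `Δ ≠ 0`, minimality, `3 ∣ Δ ∧ 3 ∤ c₄`, `E[3]` irreducible by
`card_c9408j1_11`. Grammar = p4's `X11a.ChaRecords.bsdp5_c<label>` (door `X11b.bsdp_of_ainvs_of_chaCertificate`).
PER PAIR; nothing booked. [cite: Miller2011LMS, Thm. 5.2 and Def. 1.1] [cite: Cremona2006, Table 1 (Cremona label 9408j1)] -/
theorem bsdp3_c9408j1 (hCha : thm52_padicValNat_shaOrder_le)
    (hGZK : rank_eq_analyticRank_of_analyticRank_le_one)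
    (W : WeierstrassCurve ℚ) (hW : W = ⟨0, -1, 0, -72, 162⟩)
    {N : ℕ} [NeZero N] {K : Type} [Field K] [NumberField K] (hK : IsImaginaryQuadratic K)
    (hH : SatisfiesHeegnerHypothesis N K) {P : (W.baseChange K).toAffine.Point}
    (hP : IsHeegnerPoint N W K P) (hnt : ¬ IsOfFinAddOrder P)
    (hpD : ¬ (3 : ℤ) ∣ NumberField.discr K) (hpN : ¬ 3 ^ 2 ∣ N)
    (hI : ¬ 3 ∣ (AddSubgroup.zmultiples P).index)
    (hr : W.analyticRank ≤ 1) {q : ℚ} (hq : shaAn W = (q : ℂ)) (hv : padicValRat 3 q = 0) :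
    BSDp W 3 := by
  haveI : W.IsElliptic := by rw [hW]; exact X11b.isElliptic_of_discOf_ne_zero 0 (-1) 0 (-72) 162 (by decide +kernel)
  haveI : W.IsGloballyMinimal := by rw [hW]; exact isGloballyMinimal_c9408j1
  haveI : Fact (Nat.Prime 3) := ⟨by norm_num⟩
  haveI : Fact (Nat.Prime 11) := ⟨by norm_num⟩
  have hI' : integralModelInt W = ⟨0, -1, 0, -72, 162⟩ := by
    subst hW; exact integralModelInt_eq_of_map_eq _ (map_mk_int 0 (-1) 0 (-72) 162)
  exact X11b.bsdp_of_ainvs_of_chaCertificate hCha hGZK 0 (-1) 0 (-72) 162 hI'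
    3 11 10 (by decide) (by decide +kernel) (by decide +kernel) (by decide) (by decide +kernel) card_c9408j1_11
    (by decide +kernel) hK hH hP hnt (mod_cast hpD) hpN hI hr hq hv

/-- **`9408j1 @ 3`: the UPPER half `ord_3 #Ш ≤ ord_3 #Ш_an`** (`Typed.MissingUpperBoundAt W 3`, the currency of
crux `X11aNonSurjEulerHalf`) from Cha's Heegner-index bound (`hCha`; door `Typed.missingUpperBoundAt_of_cha_of_index_le`,
`k := 0`), the index certificate displayed as `hI : ord_3 [E(K) : ℤP] ≤ 0`; `¬CM` and `E[3]` irreducible in the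
kernel. PER PAIR; nothing booked. [cite: Miller2011LMS, Thm. 5.2] [cite: Mazur1978, §6 Prop. 6.3 (1) (p. 153)]
[cite: Cremona2006, Table 1 (Cremona label 9408j1)] -/
theorem mub3_c9408j1 (hCha : thm52_padicValNat_shaOrder_le)
    (W : WeierstrassCurve ℚ) (hW : W = ⟨0, -1, 0, -72, 162⟩)
    {N : ℕ} [NeZero N] {K : Type} [Field K] [NumberField K] (hK : IsImaginaryQuadratic K)
    (hH : SatisfiesHeegnerHypothesis N K) {P : (W.baseChange K).toAffine.Point}
    (hP : IsHeegnerPoint N W K P) (hnt : ¬ IsOfFinAddOrder P)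
    (hpD : ¬ (3 : ℤ) ∣ NumberField.discr K) (hpN : ¬ 3 ^ 2 ∣ N)
    (hI : padicValNat 3 (AddSubgroup.zmultiples P).index ≤ 0)
    (hr : W.analyticRank ≤ 1) {q : ℚ} (hq : shaAn W = (q : ℂ)) (hv : (0 : ℤ) ≤ padicValRat 3 q) :
    MissingUpperBoundAt W 3 := by
  haveI : W.IsElliptic := by rw [hW]; exact X11b.isElliptic_of_discOf_ne_zero 0 (-1) 0 (-72) 162 (by decide +kernel)
  haveI : W.IsGloballyMinimal := by rw [hW]; exact isGloballyMinimal_c9408j1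
  haveI : Fact (Nat.Prime 3) := ⟨by norm_num⟩
  haveI : Fact (Nat.Prime 11) := ⟨by norm_num⟩
  have hI' : integralModelInt W = ⟨0, -1, 0, -72, 162⟩ := by
    subst hW; exact integralModelInt_eq_of_map_eq _ (map_mk_int 0 (-1) 0 (-72) 162)
  have hmult : Mult W 3 :=
    hasMultiplicativeReductionAtPrime_of_intModel hI' 3 (by decide +kernel) (by decide +kernel)
  have hcm : ¬ W.HasCM := fun h ↦ not_hasMultiplicativeReductionAtPrime_of_hasCM W h 3 hmult
  have hirr : Irr W 3 :=
    hasIrreducibleModPGaloisRep_of_intModel_of_noroot (hp := ⟨by norm_num⟩) (hℓ := ⟨by norm_num⟩)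
      hI' 3 11 (by norm_num) (by decide +kernel) card_c9408j1_11 (by decide)
  exact missingUpperBoundAt_of_cha_of_index_le W 3 hCha hcm hr hK hH hP hnt (by norm_num) hpD hpN hirr
    (k := 0) hI hq (by simpa using hv)

/-- **`9408j1 @ 3`: the UPPER half from the p3 road's UNIT-VALUE door** (no Heegner datum): the pair is
NON-split multiplicative at `3` (kernel: the node-tangent quadratic is root-free mod `3`) and
`L(E,1)/Ω_E = 1/1` is a `3`-adic unit (DISPLAYED: Cremona's `L/Ω`, binder `ht`/`hunit`; `r_an = 0` and the
image bit `¬Surj` displayed), so the constant term of the Néron-normalised Mazur–Tate–Teitelbaum function is a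
unit ⟹ analytic `μ = 0` ⟹ (corner-p1 g6 transfer, F1-mult) `μ(X(E/ℚ_∞)) = 0` ⟹ Kato's integral divisibility
⟹ (rank-`0` engine) `ord_3 #Ш ≤ ord_3 #Ш_an` — modulo the THIRTEEN named facts of
`Theorems.x11aNonSurjEulerHalf_of_katoFacts_of_muAn` (three of them construction facts, flags
`Kato-17.11-at-{nonsplit,split}-mult`, `Kato-p280-image-at-mult`) and Greenberg–Stevens at the pair. Kernel:
minimality, `Mult`, `Irr` (`card_c9408j1_11`), non-split, `¬Ram` (from `Irr ∧ ¬Surj`). PER PAIR; nothing booked.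
[cite: MazurTateTeitelbaum1986, §I.10] [cite: Wuthrich2014, Cor. 18 (p. 398)] [cite: Kato2004Asterisque, §17.13 (pp. 279–280)]
[cite: Cremona2006, Table 1 (Cremona label 9408j1)] -/
theorem mub3_c9408j1_of_katoFacts
    (hJs : thm61_splitMultiplicative) (hJn : thm61_nonsplitMultiplicative)
    (hGZK : rank_eq_analyticRank_of_analyticRank_le_one) (hmod : hasEntireLFunction_rat)
    (hpar : nonempty_modularParametrizationData)
    (hne : Kato2004.nonempty_iwasawaH1Data) (h12 : Kato2004.thm12_4)
    (hns : Kato2004.exists_multDivisibilityInputs_nonsplit)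
    (hsp : Kato2004.exists_multDivisibilityInputs_split)
    (h15 : thm15_isTorsion_multiplicative_rat)
    (h18 : Wuthrich2014.corollary18_padicLFunction_mem_iwasawaAlgebra_multiplicative)
    (hfine : Kato2004.exists_multDivisibilityInputs_fine)
    (W : WeierstrassCurve ℚ) (hW : W = ⟨0, -1, 0, -72, 162⟩)
    (hGS : ∀ [W.IsElliptic] [W.IsGloballyMinimal] [Fact (Nat.Prime 3)], greenberg_stevens (W := W) (p := 3))
    (hr : W.analyticRank = 0) (hnsj : ∀ [Fact (Nat.Prime 3)], ¬ Surj W 3)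
    (t : ℚ) (ht : W.entireLFunction 1 / (W.realPeriodRat : ℂ) = (t : ℂ)) (hunit : padicValRat 3 t = 0) :
    MissingUpperBoundAt W 3 := by
  haveI : W.IsElliptic := by rw [hW]; exact X11b.isElliptic_of_discOf_ne_zero 0 (-1) 0 (-72) 162 (by decide +kernel)
  haveI : W.IsGloballyMinimal := by rw [hW]; exact isGloballyMinimal_c9408j1
  haveI : Fact (Nat.Prime 3) := ⟨by norm_num⟩
  haveI : Fact (Nat.Prime 11) := ⟨by norm_num⟩
  have hI' : integralModelInt W = ⟨0, -1, 0, -72, 162⟩ := by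
    subst hW; exact integralModelInt_eq_of_map_eq _ (map_mk_int 0 (-1) 0 (-72) 162)
  have hmult : Mult W 3 :=
    hasMultiplicativeReductionAtPrime_of_intModel hI' 3 (by decide +kernel) (by decide +kernel)
  have hirr : Irr W 3 :=
    hasIrreducibleModPGaloisRep_of_intModel_of_noroot (hp := ⟨by norm_num⟩) (hℓ := ⟨by norm_num⟩)
      hI' 3 11 (by norm_num) (by decide +kernel) card_c9408j1_11 (by decide)
  have hnsp : ¬ W.HasSplitMultiplicativeReductionAtPrime 3 :=
    not_hasSplitMultiplicativeReductionAtPrime_of_intModel_of_noroot hI' 3 (by decide +kernel)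
      (by decide +kernel) nodal_c9408j1
  exact mub_of_unitValue_nonsplit hJs hJn hGZK hmod hpar hne h12 hns hsp h15 h18 hfine W 3 hGS
    (by decide) hr hmult hirr hnsj hnsp t ht hunit

end Summit.BirchSwinnertonDyer.Rank1Residual.X11a.ChaRecords

end
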